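import Mathlib.RingTheory.Polynomial.Cyclotomic.Eval
import Mathlib.RingTheory.Polynomial.Cyclotomic.Basic
import Mathlib.RingTheory.DiscreteValuationRing.Basic
import Mathlib.RingTheory.LocalRing.ResidueField.Basic
import Mathlib.Algebra.CharP.Lemmas
import HarnessLib

/-!
# Arithmetic calibration of the idea card 1 of `res-L1-w45b-idea-2` (former card 3 `wild-eggers-depth`): Gaussian depth
# two and the wild contact of a Kummer orbit (crux `EquisingularLift`, honest variant EL♮ = `EquisingularLiftNat`,
# stmt-ResolutionOfSingularities-20038)

[OURS · L W4.5 (b)] Helper for the CALIBRATION statements (former card 3 `wild-eggers-depth`, withdrawn as a card in round 2 and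
kept as arithmetic calibration of card 1 `unscrew-split-orbits`) of `res-L1-w45b-idea-2` (`Cruxes/EquisingularLift/Ideas/`, Sketch
`HOME/L/res-L1-w45b-idea-2/Sketch-L1-idea-2.lean` v5, decls `GaussianDepthTwo` l. 152, `KummerOrbitWildContact` l. 166). NOT statements
of the manuscript under review (Hironaka 2017); nothing here is attributed to its author. Pure commutative algebra; both theorems named
as in the Sketch have the Sketch's signature VERBATIM.

* `GaussianDepthTwo` — in a local ring with `2 ∈ 𝔪` and `i² = −1`: `(1 + i)² = 2i`, so `1 + i ∈ 𝔪` and `2 = −i(1+i)² ∈ 𝔪²`;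
  hence `(y + i) − (y − i) = 2i ∈ 𝔪²`.
* `KummerOrbitWildContact` — in a DVR `O'` with `p ∈ 𝔪` and a primitive `p`-th root of unity `ζ`: every `p`-th root of unity
  is `≡ 1 (mod 𝔪)` (the residue field has characteristic `p`, where `(μ̄ − 1)ᵖ = μ̄ᵖ − 1 = 0`); `p = Φ_p(1) = ∏ (1 − μ)` over the
  `p − 1` primitive roots `μ` (Mathlib `eval_one_cyclotomic_prime`, `cyclotomic_eq_prod_X_sub_primitiveRoots`,
  `IsPrimitiveRoot.card_primitiveRoots`), so `p ∈ 𝔪^{p−1}`; and `ζᵃα − α = (ζᵃ − 1)α ∈ 𝔪·𝔪`.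

AI-written; AI review is weaker than expert review.
-/

set_option linter.dupNamespace false

noncomputable section

namespace Summit.ResolutionOfSingularities.ResolutionOfSingularities.Theorems.EquisingularLift.RamifiedCoalescence

open IsLocalRing Polynomial

/-- **Card 3, step (a) (Sketch `GaussianDepthTwo`, VERBATIM).** In any local ring with `2 ∈ 𝔪` containing `i` (`i² = −1`)
one has `2 = −i(1+i)² ∈ 𝔪²`, hence `(y+i) − (y−i) = 2i ∈ 𝔪²`. OURS. -/
theorem GaussianDepthTwo :
  ∀ (O' : Type) [CommRing O'] [IsLocalRing O'] (i : O'), i ^ 2 = -1 →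
    (2 : O') ∈ maximalIdeal O' → (2 : O') ∈ maximalIdeal O' ^ 2 ∧ ∀ y : O', (y + i) - (y - i) ∈ maximalIdeal O' ^ 2 := by
  intro O' _ _ i hi h2
  have hsq : (1 + i) ^ 2 = 2 * i := by linear_combination hi
  have h1i : 1 + i ∈ maximalIdeal O' := by
    apply Ideal.IsPrime.mem_of_pow_mem inferInstance 2
    rw [hsq]
    exact Ideal.mul_mem_right i _ h2
  have h2sq : (2 : O') ∈ maximalIdeal O' ^ 2 := by
    have hmem : (1 + i) ^ 2 ∈ maximalIdeal O' ^ 2 := Ideal.pow_mem_pow h1i 2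
    have heq : (2 : O') = -i * (1 + i) ^ 2 := by linear_combination (i + 2) * hi
    rw [heq]
    exact Ideal.mul_mem_left _ _ hmem
  refine ⟨h2sq, fun y => ?_⟩
  have : (y + i) - (y - i) = 2 * i := by ring
  rw [this]
  exact Ideal.mul_mem_right i _ h2sq

/-- A product of `s.card` elements of an ideal `I` lies in `I ^ s.card`. OURS (Mathlib `Ideal.prod_mem_prod` with a constant
family). -/
theorem prod_mem_pow_card {R : Type*} [CommRing R] {ι : Type*} (s : Finset ι) (I : Ideal R) (f : ι → R)
    (h : ∀ j ∈ s, f j ∈ I) : (∏ j ∈ s, f j) ∈ I ^ s.card := by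
  have := Ideal.prod_mem_prod (s := s) (I := fun _ => I) (x := f) h
  simpa [Finset.prod_const] using this

/-- In a local ring whose maximal ideal contains the prime `p`, every `p`-th root of unity is `≡ 1 (mod 𝔪)`: in the
residue field, of characteristic `p`, `(μ̄ − 1)ᵖ = μ̄ᵖ − 1 = 0`. OURS. -/
theorem sub_one_mem_maximalIdeal_of_pow_prime_eq_one {O' : Type*} [CommRing O'] [IsLocalRing O'] {p : ℕ}
    (hp : p.Prime) (hpm : (p : O') ∈ maximalIdeal O') {μ : O'} (hμ : μ ^ p = 1) : μ - 1 ∈ maximalIdeal O' := by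
  rw [← IsLocalRing.residue_eq_zero_iff]
  have hp0 : (p : ResidueField O') = 0 := by
    have := (IsLocalRing.residue_eq_zero_iff (p : O')).mpr hpm
    simpa using this
  haveI : Fact p.Prime := ⟨hp⟩
  haveI : CharP (ResidueField O') p := (CharP.charP_iff_prime_eq_zero hp).mpr hp0
  have h1 : (IsLocalRing.residue O' μ - 1) ^ p = 0 := by
    rw [sub_pow_char, ← map_pow, hμ, map_one, one_pow, sub_self]
  have h2 : IsLocalRing.residue O' μ - 1 = 0 := pow_eq_zero_iff (hp.ne_zero) |>.mp h1
  simpa using h2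

-- Mathlib's `IsDiscreteValuationRing O'` takes `[IsDomain O']` as a parameter, so the `overlappingInstances` lint (both
-- imply `Nontrivial`) is unavoidable for the Sketch's DVR binder and is silenced for this statement only (as in the Sketch).
set_option linter.overlappingInstances false in
/-- **Card 3, step (b) (Sketch `KummerOrbitWildContact`, VERBATIM).** In a DVR of residue characteristic `p` containing a
primitive `p`-th root of unity `ζ`: `p ∈ 𝔪^{p−1}`, `ζ − 1 ∈ 𝔪`, and the conjugates `ζᵃ · α` of a Kummer point `α ∈ 𝔪` differ
from `α` by `(ζᵃ − 1) α ∈ 𝔪²`. Proof: `p = Φ_p(1) = ∏_{μ primitive} (1 − μ)`, `p − 1` factors each in `𝔪`. OURS. -/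
theorem KummerOrbitWildContact :
  ∀ (p : ℕ), p.Prime → ∀ (O' : Type) [CommRing O'] [IsDomain O'] [IsDiscreteValuationRing O'] (ζ α : O'),
    IsPrimitiveRoot ζ p → (p : O') ∈ maximalIdeal O' → α ∈ maximalIdeal O' →
    (p : O') ∈ maximalIdeal O' ^ (p - 1) ∧ ζ - 1 ∈ maximalIdeal O' ∧ ∀ a : ℕ, ζ ^ a * α - α ∈ maximalIdeal O' ^ 2 := by
  intro p hp O' _ _ _ ζ α hζ hpm hα
  haveI : Fact p.Prime := ⟨hp⟩
  -- every `p`-th root of unity is `≡ 1`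
  have hroot : ∀ μ : O', μ ^ p = 1 → μ - 1 ∈ maximalIdeal O' := fun μ hμ =>
    sub_one_mem_maximalIdeal_of_pow_prime_eq_one hp hpm hμ
  refine ⟨?_, hroot ζ hζ.pow_eq_one, fun a => ?_⟩
  · -- `p = ∏_{μ ∈ primitiveRoots p O'} (1 − μ)`
    have hcyc := cyclotomic_eq_prod_X_sub_primitiveRoots hζ
    have heval : ((p : ℕ) : O') = ∏ μ ∈ primitiveRoots p O', (1 - μ) := by
      have h1 := eval_one_cyclotomic_prime (R := O') (p := p)
      rw [hcyc, Polynomial.eval_prod] at h1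
      simp only [Polynomial.eval_sub, Polynomial.eval_X, Polynomial.eval_C] at h1
      exact h1.symm
    have hcard : (primitiveRoots p O').card = p - 1 := by
      rw [hζ.card_primitiveRoots, Nat.totient_prime hp]
    rw [heval, ← hcard]
    apply prod_mem_pow_card
    intro μ hμ
    have hμ' : IsPrimitiveRoot μ p := (mem_primitiveRoots hp.pos).mp hμ
    have := hroot μ hμ'.pow_eq_one
    rw [← Ideal.neg_mem_iff, neg_sub] at this
    exact this
  · have hζa : ζ ^ a - 1 ∈ maximalIdeal O' := by
      apply hroot
      rw [← pow_mul, mul_comm, pow_mul, hζ.pow_eq_one, one_pow]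
    have : ζ ^ a * α - α = (ζ ^ a - 1) * α := by ring
    rw [this, pow_two]
    exact Ideal.mul_mem_mul hζa hα

end Summit.ResolutionOfSingularities.ResolutionOfSingularities.Theorems.EquisingularLift.RamifiedCoalescence
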